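import Summits.SmoothPoincare4.SmoothPoincare4.Theorems.InformationMetricHadamardAhHadamardFillingStubCollarPackage
import Summits.SmoothPoincare4.SmoothPoincare4.Theorems.InformationMetricHadamardAhHadamardFillingStubHadamardConvexBodyBoundary
import Summits.SmoothPoincare4.SmoothPoincare4.Theorems.InformationMetricHadamardAhHadamardFillingStubHadamardLocallyConvexIsConvex
import Summits.SmoothPoincare4.SmoothPoincare4.Theorems.InformationMetricHadamardAhHadamardFillingStubLocallyConvexCore

/-!
# Stub `stub_locallyConvexEndForcesHadamard` (K1) of line `Sketch` for crux `AhHadamardFilling`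
(item stmt-SmoothPoincare4-6014, route `InformationMetricHadamard`; lead reshape r3)

**K1 (`LocallyConvexEndForcesHadamard`)**: a complete CONNECTED Riemannian 5-manifold `(W, G)` with
`sec ≤ 0` whose only end is a proper smooth injective immersive collar `Φ` over a homotopy 4-sphere
`S`, with one far complement `K_t = (Φ(S × (0,t)))ᶜ` of nonempty interior which is `δ`-locally
`d`-convex, is SIMPLY CONNECTED and `S ≅ S⁴` — the recognition engine of the route (it strictly
strengthens items 6016 `HadamardConvexBoundarySphere` / 6017 `ConvexEndRecognition`: no simple
connectivity assumed, local convexity only), idea card `convex-slice-lifts-to-cover`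
(S. Alexander, PAMS 64 (1977) 321–325, made synthetic).

Assembly of the landed stubs of the line: the collar package (`stub_collarPackage`: far parts open,
`∂K_t = Φ(S × {t})`, vertical retraction, slice immersion, `S` simply connected), the core reduction
(`stub_locallyConvexCoreForcesHadamard`: universal Riemannian cover `exp_p`, from A1, A2), and the
two convexity theorems A1 (`stub_hadamardLocallyConvexIsConvex`, Karcher 1968 / Tietze–Nakajima) and
A2 (`stub_hadamardConvexBodyBoundary`, convex bodies of Hadamard manifolds have spherical boundary).
Pure glue; no definitions, no named facts.
-/

noncomputable section

-- the prescribed namespace `Summit.<P>.<Sub>.…` duplicates `SmoothPoincare4` (P = Sub)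
set_option linter.dupNamespace false

open scoped Manifold ContDiff Topology ENNReal NNReal
open Set Function

namespace Summit.SmoothPoincare4.SmoothPoincare4.Cruxes.AhHadamardFilling.Sketch

open Literature.Topology.FourManifolds (HomotopySphere)
open Literature.Geometry.Lorentzian (PseudoRiemannianMetric)

/-! ## K1 from A1, A2 via the core reduction and the collar package -/

/-- **K1 given A1, A2** (A1, A2 as hypotheses `hA1`, `hA2`): the far
complement `K_t` of the collar, the vertical retraction and the slice `σ ↦ Φ(σ,t)` (collar package)
feed the core reduction. -/
theorem locallyConvexEndForcesHadamard_of_facts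
    (hA1 : ∀ (X : Type) [TopologicalSpace X] [T2Space X] [SecondCountableTopology X]
      [ChartedSpace (EuclideanSpace ℝ (Fin 5)) X] [IsManifold (𝓡 5) ∞ X] [SimplyConnectedSpace X]
      (G : PseudoRiemannianMetric (𝓡 5) ∞ (EuclideanSpace ℝ (Fin 5)) (TangentSpace (𝓡 5) : X → Type _))
      (hG : G.IsRiemannian),
      (∀ (x : X) (r : NNReal), IsCompact {y : X | G.edist hG x y ≤ r}) →
      (∀ cov, G.IsLeviCivita cov →
        ∀ (x : X) (U V : TangentSpace (𝓡 5) x), G.sectionalCurvature cov x U V ≤ 0) →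
      ∀ (C : Set X), IsClosed C → IsConnected C →
      (∀ p ∈ C, ∃ δ : ℝ, 0 < δ ∧ ∀ q ∈ C, ∀ q' ∈ C,
        G.edist hG p q < ENNReal.ofReal δ → G.edist hG p q' < ENNReal.ofReal δ →
        ∀ m : X, G.edist hG q m + G.edist hG m q' = G.edist hG q q' → m ∈ C) →
      ∀ p ∈ C, ∀ q ∈ C, ∀ m : X, G.edist hG p m + G.edist hG m q = G.edist hG p q → m ∈ C)
    (hA2 : ∀ (X : Type) [TopologicalSpace X] [T2Space X] [SecondCountableTopology X]
      [ChartedSpace (EuclideanSpace ℝ (Fin 5)) X] [IsManifold (𝓡 5) ∞ X] [SimplyConnectedSpace X]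
      (G : PseudoRiemannianMetric (𝓡 5) ∞ (EuclideanSpace ℝ (Fin 5)) (TangentSpace (𝓡 5) : X → Type _))
      (hG : G.IsRiemannian),
      (∀ (x : X) (r : NNReal), IsCompact {y : X | G.edist hG x y ≤ r}) →
      (∀ cov, G.IsLeviCivita cov →
        ∀ (x : X) (U V : TangentSpace (𝓡 5) x), G.sectionalCurvature cov x U V ≤ 0) →
      ∀ (C : Set X), IsClosed C → (interior C).Nonempty →
      (∀ p ∈ C, ∀ q ∈ C, ∀ m : X, G.edist hG p m + G.edist hG m q = G.edist hG p q → m ∈ C) →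
      ∀ (N : Type) [TopologicalSpace N] [T2Space N] [SecondCountableTopology N] [CompactSpace N]
        [Nonempty N] [ChartedSpace (EuclideanSpace ℝ (Fin 4)) N] [IsManifold (𝓡 4) ∞ N] (j : N → X),
      ContMDiff (𝓡 4) (𝓡 5) ∞ j → Injective j →
      (∀ x : N, Injective (mfderiv (𝓡 4) (𝓡 5) j x)) → range j ⊆ frontier C →
      IsOpen (((↑) : frontier C → X) ⁻¹' range j) →
      IsCompact C ∧ range j = frontier C ∧ Nonempty (N ≃ₘ⟮𝓡 4, 𝓡 4⟯ (Metric.sphere (0 : EuclideanSpace ℝ (Fin 5)) 1)))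
    (S : HomotopySphere 4) (W : Type) [TopologicalSpace W] [T2Space W] [SecondCountableTopology W]
    [ChartedSpace (EuclideanSpace ℝ (Fin 5)) W] [IsManifold (𝓡 5) ∞ W] [ConnectedSpace W]
    (G : PseudoRiemannianMetric (𝓡 5) ∞ (EuclideanSpace ℝ (Fin 5)) (TangentSpace (𝓡 5) : W → Type _)) (hG : G.IsRiemannian)
    (Φ : S.carrier × ℝ → W)
    (hcpt : ∀ (x : W) (r : NNReal), IsCompact {y : W | G.edist hG x y ≤ r})
    (hsec : ∀ cov, G.IsLeviCivita cov →
      ∀ (x : W) (X Y : TangentSpace (𝓡 5) x), G.sectionalCurvature cov x X Y ≤ 0)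
    (hsm : ContMDiffOn ((𝓡 4).prod 𝓘(ℝ, ℝ)) (𝓡 5) ∞ Φ (univ ×ˢ Ioo (0 : ℝ) 1))
    (hinj : InjOn Φ (univ ×ˢ Ioo (0 : ℝ) 1))
    (himm : ∀ p ∈ univ ×ˢ Ioo (0 : ℝ) 1,
      Function.Injective (mfderiv ((𝓡 4).prod 𝓘(ℝ, ℝ)) (𝓡 5) Φ p))
    (_hco : ∀ t ∈ Ioo (0 : ℝ) 1, IsCompact (Φ '' (univ ×ˢ Ioo (0 : ℝ) t))ᶜ)
    (hcl : ∀ t ∈ Ioo (0 : ℝ) 1, closure (Φ '' (univ ×ˢ Ioo (0 : ℝ) t)) ⊆ Φ '' (univ ×ˢ Ioo (0 : ℝ) 1))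
    (hconv : ∃ t ∈ Ioo (0 : ℝ) 1, ∃ δ : ℝ, 0 < δ ∧
      (interior (Φ '' (univ ×ˢ Ioo (0 : ℝ) t))ᶜ).Nonempty ∧
      ∀ p ∈ (Φ '' (univ ×ˢ Ioo (0 : ℝ) t))ᶜ, ∀ q ∈ (Φ '' (univ ×ˢ Ioo (0 : ℝ) t))ᶜ,
        G.edist hG p q < ENNReal.ofReal δ →
        ∀ m : W, G.edist hG p m + G.edist hG m q = G.edist hG p q → m ∈ (Φ '' (univ ×ˢ Ioo (0 : ℝ) t))ᶜ) :
    SimplyConnectedSpace W ∧ Nonempty (S.carrier ≃ₘ⟮𝓡 4, 𝓡 4⟯ (Metric.sphere (0 : EuclideanSpace ℝ (Fin 5)) 1)) := by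
  obtain ⟨t, ht, δ, hδ, hint, hconv'⟩ := hconv
  obtain ⟨hne, hsc, hopen, hfr, ⟨Hr, h0, h1, hK⟩, hιs, hιimm⟩ :=
    stub_collarPackage S W Φ hsm hinj himm hcl t ht
  haveI : Nonempty S.carrier := hne
  haveI : SimplyConnectedSpace S.carrier := hsc
  have hιinj : Injective (fun σ : S.carrier ↦ Φ (σ, t)) := fun a b hab ↦ by
    have h := hinj ⟨mem_univ _, ht⟩ ⟨mem_univ _, ht⟩ hab
    exact congrArg Prod.fst h
  have hιK : range (fun σ : S.carrier ↦ Φ (σ, t)) = frontier (Φ '' (univ ×ˢ Ioo (0 : ℝ) t))ᶜ := by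
    rw [hfr]
    ext y
    constructor
    · rintro ⟨σ, rfl⟩
      exact ⟨(σ, t), ⟨mem_univ _, rfl⟩, rfl⟩
    · rintro ⟨x, hx, rfl⟩
      have hx2 : x.2 = t := hx.2
      exact ⟨x.1, by rw [← hx2]⟩
  exact stub_locallyConvexCoreForcesHadamard hA1 hA2 W G hG hcpt hsec
    (Φ '' (univ ×ˢ Ioo (0 : ℝ) t))ᶜ hopen.isClosed_compl hint hδ
    hconv' Hr h0 h1 hK S.carrier (fun σ : S.carrier ↦ Φ (σ, t)) hιs hιinj hιimm hιK

/-- **K1 (`stub_locallyConvexEndForcesHadamard`, registered)**, from the landed A1, A2, core and collar package.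
A complete connected Riemannian 5-manifold `(W, G)` with `sec ≤ 0`, a proper smooth injective
immersive end collar `Φ` over a homotopy 4-sphere `S`, and one far complement `K_t` with nonempty
interior which is `δ`-locally `d`-convex, is simply connected, and `S ≅ S⁴`. -/
theorem stub_locallyConvexEndForcesHadamard
    (S : HomotopySphere 4) (W : Type) [TopologicalSpace W] [T2Space W] [SecondCountableTopology W]
    [ChartedSpace (EuclideanSpace ℝ (Fin 5)) W] [IsManifold (𝓡 5) ∞ W] [ConnectedSpace W]
    (G : PseudoRiemannianMetric (𝓡 5) ∞ (EuclideanSpace ℝ (Fin 5)) (TangentSpace (𝓡 5) : W → Type _)) (hG : G.IsRiemannian)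
    (Φ : S.carrier × ℝ → W)
    (hcpt : ∀ (x : W) (r : NNReal), IsCompact {y : W | G.edist hG x y ≤ r})
    (hsec : ∀ cov, G.IsLeviCivita cov →
      ∀ (x : W) (X Y : TangentSpace (𝓡 5) x), G.sectionalCurvature cov x X Y ≤ 0)
    (hsm : ContMDiffOn ((𝓡 4).prod 𝓘(ℝ, ℝ)) (𝓡 5) ∞ Φ (univ ×ˢ Ioo (0 : ℝ) 1))
    (hinj : InjOn Φ (univ ×ˢ Ioo (0 : ℝ) 1))
    (himm : ∀ p ∈ univ ×ˢ Ioo (0 : ℝ) 1,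
      Function.Injective (mfderiv ((𝓡 4).prod 𝓘(ℝ, ℝ)) (𝓡 5) Φ p))
    (hco : ∀ t ∈ Ioo (0 : ℝ) 1, IsCompact (Φ '' (univ ×ˢ Ioo (0 : ℝ) t))ᶜ)
    (hcl : ∀ t ∈ Ioo (0 : ℝ) 1, closure (Φ '' (univ ×ˢ Ioo (0 : ℝ) t)) ⊆ Φ '' (univ ×ˢ Ioo (0 : ℝ) 1))
    (hconv : ∃ t ∈ Ioo (0 : ℝ) 1, ∃ δ : ℝ, 0 < δ ∧
      (interior (Φ '' (univ ×ˢ Ioo (0 : ℝ) t))ᶜ).Nonempty ∧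
      ∀ p ∈ (Φ '' (univ ×ˢ Ioo (0 : ℝ) t))ᶜ, ∀ q ∈ (Φ '' (univ ×ˢ Ioo (0 : ℝ) t))ᶜ,
        G.edist hG p q < ENNReal.ofReal δ →
        ∀ m : W, G.edist hG p m + G.edist hG m q = G.edist hG p q → m ∈ (Φ '' (univ ×ˢ Ioo (0 : ℝ) t))ᶜ) :
    SimplyConnectedSpace W ∧ Nonempty (S.carrier ≃ₘ⟮𝓡 4, 𝓡 4⟯ (Metric.sphere (0 : EuclideanSpace ℝ (Fin 5)) 1)) :=
  locallyConvexEndForcesHadamard_of_facts stub_hadamardLocallyConvexIsConvex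
    stub_hadamardConvexBodyBoundary S W G hG Φ hcpt hsec hsm hinj himm hco hcl hconv


end Summit.SmoothPoincare4.SmoothPoincare4.Cruxes.AhHadamardFilling.Sketch

end
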